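import Summits.QuantumFields.YangMills.Theorems.UnitScaleTiltProp8FlatCubeSequenceAligned
import Summits.QuantumFields.YangMills.Theorems.UnitScaleTiltProp8FlatPortChart
import HarnessLib

/-!
# Route `UnitScaleTilt`, crux K1 child «MinimiserStabilityRegPr» (stmt-QuantumFields-19200), registered stub V2′ `stub_halvingStep` (v8 5b4e846794b80374 ∕ v10
# `BirthV10`) — pillars P2∕P3b geometry: **ON THE ALIGNED CUBE SEQUENCE (144), FINE SITES WITHIN SUP-DISTANCE `2` HAVE LEVELS AT MOST ONE APART** (for a separation
# `S ≥ 2L`), hence the P2 level weights `w₁(b) = L^{j(b₋)}η` are `L`-comparable within distance `2` — the one displayed geometric input (`hcmp`, `Λ = L`) of this seat's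
# level-weighted Proposition 4 (98) `FlatProp4Bg1.weighted98_dom_T3` (`UnitScaleTiltProp8FlatProp4Bg1Weighted`)

Cell `ym3-torus` (HUMAN RULING D-0037, YM ladder rung R3 — continuum SU(2) YM₃ on the torus is a RUNG, not the Clay problem), width seat `ym-ust-19200-w5` gen 2.
`--supports stmt-QuantumFields-19200 --as helper`; def-free, 0 sorry, standard axioms.  Elementary lattice geometry over ym3-torus-p1 g15's `FlatCubeSequenceAligned`
(`cubeFinM`, `cubeSeqM`, `radM_succ`: `radM (i+1) = L·radM i + (LM − 1) + S`) and `FlatPortChart.pow_mul_distSite_iterBlockOf_le`.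

THE PRINT: [Balaban1984PropagatorsII] (2.1)–(2.2) p. 224 (*«dist(Ω_{j+1}, Ω_jᶜ) > RM L^jη»* — consecutive domains are separated, so neighbouring blocks differ by at most
one level); [Balaban1985Variational] (144) p. 300 (*«□₀ ⊃ □₁ ⊃ … ⊃ □_k, dist(□_{n+1}, □_nᶜ) = R₁M₁Lⁿη»*), p. 286 (the level-weighted norms).

WHAT THIS FILE PROVES (every `Params` `P`, centre `x₀`, `k ≤ m + K`, `1 ≤ M`, separation `2L ≤ S`):
* §1 **`inOm_pred_of_dist_le_two`** — if the `j`-block of `x` lies in `□_j` and `dist₀(x, x′) ≤ 2` then the `(j−1)`-block of `x′` lies in `□_{j−1}` (the child blocks of a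
  neighbour of a member of the `M`-saturated ball of radius `R` lie within `L(R + M + 1) + L − 1 ≤ L·R + (LM − 1) + S` of the next centre).
* §2 **`levOf_le_levOf_add_one`** — `j(x) ≤ j(x′) + 1` for `dist₀(x, x′) ≤ 2` (and symmetrically).
* §3 **`levWeight_le_mul_of_dist_le_two`** (d = 3 carrier, `D = cubeSeqMT3 F n K x₀ ρ S M`, `IsLevWeight` weights): `w 1 b ≤ L · w 1 b′` whenever `dist₀(b′₋, b₋) ≤ 2` —
  the `hcmp` hypothesis of `FlatProp4Bg1.weighted98_dom_T3` with `Λ = L`.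
HONEST SCOPE: geometry only; `2L ≤ S` is a (free) choice of the cube-sequence separation, compatible with the package's `R·M ≤ S`; NOT a claim about the stub, the crux,
the rung or the gap.

References: T. Bałaban, CMP **96** (1984) 223–250 [Balaban1984PropagatorsII] (2.1)–(2.4) p.224; CMP **102** (1985) 277–309 [Balaban1985Variational] (144) p.300, p.286.
-/

set_option autoImplicit false

noncomputable section

namespace Summit.QuantumFields.YangMills.Theorems.FlatCubeSequenceAligned

open Literature.MathematicalPhysics.QuantumFieldTheory.Balaban1983to89
open B5Eq117TorusCarriers (Mk)
open B5Eq118OneStroke (iterBlockOf)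
open B5Prop12FieldsLattice (distSite distSite_nonneg)
open B5RowSumsP12Lattice (distSite_comm distSite_triangle)
open B6SectADomainsV1 (Domains)
open B11Eq115Space (levOf levOf_le mem_levOf le_levOf)
open FlatCubeSequence (distSite_le_blockOf iterBlockOf_succ')
open FlatPortChart (pow_mul_distSite_iterBlockOf_le)

variable {P : Params}

/-! ## §1 Neighbours drop at most one level -/

/-- **NEIGHBOURS DROP AT MOST ONE LEVEL ON THE ALIGNED CUBE SEQUENCE**: for `2L ≤ S`, if the `j`-block of `x` lies in `□_j` (`InOm j x`) and `dist₀(x, x′) ≤ 2`, then the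
`(j−1)`-block of `x′` lies in `□_{j−1}`. [cite: Balaban1984PropagatorsII, (2.1)-(2.2) p.224; Balaban1985Variational, (144) p.300] -/
theorem inOm_pred_of_dist_le_two (x₀ : Site P 0) {k : ℕ} (hk : k ≤ P.m + P.K) (ρ S M : ℕ) (hM : 1 ≤ M) (hS : 2 * P.L ≤ S)
    {j : ℕ} {x x' : Site P 0} (hx : (cubeSeqM x₀ k hk ρ S M hM).InOm j x) (hd : distSite (Mk P 0) x x' ≤ 2) :
    (cubeSeqM x₀ k hk ρ S M hM).InOm (j - 1) x' := by
  rcases Nat.lt_or_ge j 2 with hj | hj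
  · have h0 : j - 1 = 0 := by omega
    rw [h0]
    exact (cubeSeqM x₀ k hk ρ S M hM).inOm_zero x'
  · obtain ⟨i, rfl⟩ : ∃ i, j = i + 1 := ⟨j - 1, by omega⟩
    have hi1 : 1 ≤ i := by omega
    rw [Nat.add_sub_cancel]
    -- `i + 1 ≤ k` (else `□_{i+1} = ∅`)
    have hik : i + 1 ≤ k := by
      by_contra hcon
      have hempty : (cubeSeqM x₀ k hk ρ S M hM).Om (i + 1) = ∅ := (cubeSeqM x₀ k hk ρ S M hM).Om_eq_empty (by simp; omega)
      unfold Domains.InOm at hx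
      rw [hempty] at hx
      simp at hx
    have hle : i + 1 ≤ P.m + P.K := hik.trans hk
    have hL1 : (1 : ℝ) ≤ P.L := by exact_mod_cast P.L_pos
    have hL0 : (0 : ℝ) ≤ P.L := by linarith
    -- the `(i+1)`-block of `x` in the aligned cube
    have hy : iterBlockOf (i + 1) x ∈ cubeFinM x₀ k ρ S M (i + 1) := by
      have h := hx
      unfold Domains.InOm at h
      rwa [cubeSeqM_Om_pos x₀ hk ρ S M hM (by omega) hik] at h
    have d1 := dist_le_of_mem_cubeFinM (x₀ := x₀) (k := k) (ρ := ρ) (S := S) hM hy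
    -- the `(i+1)`-blocks of `x`, `x′` are within `2`
    have d2 : distSite (Mk P (i + 1)) (iterBlockOf (i + 1) x') (iterBlockOf (i + 1) x) ≤ 2 := by
      have h := pow_mul_distSite_iterBlockOf_le (i + 1) hle x' x
      have hxx : distSite (Mk P 0) x' x ≤ 2 := by rw [distSite_comm]; exact hd
      have hLp : (1 : ℝ) ≤ (P.L : ℝ) ^ (i + 1) := one_le_pow₀ hL1
      have hnn : (0 : ℝ) ≤ distSite (Mk P (i + 1)) (iterBlockOf (i + 1) x') (iterBlockOf (i + 1) x) := distSite_nonneg _ _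
      by_contra hgt
      rw [not_le] at hgt
      nlinarith
    have d3 : distSite (Mk P (i + 1)) (iterBlockOf (i + 1) x') (iterBlockOf (i + 1) x₀) ≤ (radM P.L M ρ S (k - (i + 1)) : ℝ) + ((M : ℝ) - 1) + 2 := by
      have htri := distSite_triangle (Mk P (i + 1)) (iterBlockOf (i + 1) x') (iterBlockOf (i + 1) x) (iterBlockOf (i + 1) x₀)
      linarith
    -- one level down
    have d4 : distSite (Mk P i) (iterBlockOf i x') (iterBlockOf i x₀) ≤
        (P.L : ℝ) * ((radM P.L M ρ S (k - (i + 1)) : ℝ) + ((M : ℝ) - 1) + 2) + ((P.L : ℝ) - 1) := by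
      have h := distSite_le_blockOf hle (iterBlockOf i x') (iterBlockOf i x₀)
      rw [← iterBlockOf_succ', ← iterBlockOf_succ'] at h
      have := mul_le_mul_of_nonneg_left d3 hL0
      linarith
    have hrad : (P.L : ℝ) * ((radM P.L M ρ S (k - (i + 1)) : ℝ) + ((M : ℝ) - 1) + 2) + ((P.L : ℝ) - 1) ≤ (radM P.L M ρ S (k - i) : ℝ) := by
      have hki : k - i = (k - (i + 1)) + 1 := by omega
      rw [hki, radM_succ]
      have hLM : 1 ≤ P.L * M := Nat.one_le_iff_ne_zero.mpr (Nat.mul_ne_zero P.L_pos.ne' (by omega))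
      have hsub : ((P.L * M - 1 : ℕ) : ℝ) = (P.L : ℝ) * M - 1 := by rw [Nat.cast_sub hLM, Nat.cast_mul, Nat.cast_one]
      have hS' : 2 * (P.L : ℝ) ≤ (S : ℝ) := by exact_mod_cast hS
      push_cast
      rw [hsub]
      nlinarith
    have hmem : iterBlockOf i x' ∈ cubeFinM x₀ k ρ S M i := mem_cubeFinM_of_dist x₀ k ρ S M i (d4.trans hrad)
    unfold Domains.InOm
    rw [cubeSeqM_Om_pos x₀ hk ρ S M hM hi1 (by omega)]
    exact hmem

/-! ## §2 The level map is 1-Lipschitz at scale `2` -/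

/-- **`j(x) ≤ j(x′) + 1` FOR `dist₀(x, x′) ≤ 2`** (the level = the largest `j` with the `j`-block in `□_j`; `2L ≤ S`).
[cite: Balaban1984PropagatorsII, (2.3)-(2.4) p.224; Balaban1985Variational, p.286] -/
theorem levOf_le_levOf_add_one (x₀ : Site P 0) {k : ℕ} (hk : k ≤ P.m + P.K) (ρ S M : ℕ) (hM : 1 ≤ M) (hS : 2 * P.L ≤ S)
    {x x' : Site P 0} (hd : distSite (Mk P 0) x x' ≤ 2) :
    levOf (fun j => {y : Site P 0 | (cubeSeqM x₀ k hk ρ S M hM).InOm j y}) k x ≤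
      levOf (fun j => {y : Site P 0 | (cubeSeqM x₀ k hk ρ S M hM).InOm j y}) k x' + 1 := by
  set lx := levOf (fun j => {y : Site P 0 | (cubeSeqM x₀ k hk ρ S M hM).InOm j y}) k x with hlx
  have hmem : (cubeSeqM x₀ k hk ρ S M hM).InOm lx x :=
    mem_levOf (Ω := fun j => {y : Site P 0 | (cubeSeqM x₀ k hk ρ S M hM).InOm j y}) (fun y => (cubeSeqM x₀ k hk ρ S M hM).inOm_zero y) k x
  have hpred := inOm_pred_of_dist_le_two x₀ hk ρ S M hM hS hmem hd
  have hlk : lx ≤ k := levOf_le _ _ _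
  have h := le_levOf (Ω := fun j => {y : Site P 0 | (cubeSeqM x₀ k hk ρ S M hM).InOm j y}) (k := k) (j := lx - 1) (by omega) hpred
  omega

/-! ## §3 The P2 level weights are `L`-comparable within distance `2` (d = 3 carrier) -/

section T3

open T3ContinuumYM3Torus (T3Family)
open FlatCubeOpsText (IsLevWeight)

/-- **`w₁(b) ≤ L·w₁(b′)` WHENEVER `dist₀(b′₋, b₋) ≤ 2`** for the level weights `w m b = (L^{j(b₋)}η)^m` of the aligned cube sequence `cubeSeqMT3 F n K x₀ ρ S M` with `2L ≤ S` —
the `hcmp` hypothesis (`Λ = L`) of `FlatProp4Bg1.weighted98_dom_T3`. [cite: Balaban1985Variational, p.286, (144) p.300; Balaban1984PropagatorsII, (2.1)-(2.2) p.224] -/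
theorem levWeight_le_mul_of_dist_le_two (F : T3Family) (n K : ℕ) (x₀ : Site (F.P K) 0) (ρ S M : ℕ) (hM : 1 ≤ M) (hS : 2 * F.L ≤ S)
    {w : ℕ → PBond (F.P K) 0 → ℝ} (hw : IsLevWeight F n K (cubeSeqMT3 F n K x₀ ρ S M hM) w)
    (b b' : PBond (F.P K) 0) (hd : distSite (Mk (F.P K) 0) b'.src b.src ≤ 2) :
    w 1 b ≤ (F.L : ℝ) * w 1 b' := by
  have hL1 : (1 : ℝ) ≤ F.L := by exact_mod_cast F.hL.2.le
  have hη : 0 < ((F.L : ℝ)⁻¹) ^ (K - n) := pow_pos (inv_pos.mpr (by linarith)) _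
  have hS' : 2 * (F.P K).L ≤ S := by simpa using hS
  have hlev := levOf_le_levOf_add_one x₀ (FlatMinimizerH.le_T3 F n K) ρ S M hM hS' (x := b.src) (x' := b'.src) (by rw [distSite_comm]; exact hd)
  rw [hw 1 b, hw 1 b', pow_one, pow_one]
  have hLF : ((F.P K).L : ℝ) = (F.L : ℝ) := by simp
  have hpow : (F.L : ℝ) ^ levOf (fun j => {y : Site (F.P K) 0 | (cubeSeqMT3 F n K x₀ ρ S M hM).InOm j y}) (K - n) b.src ≤
      (F.L : ℝ) * (F.L : ℝ) ^ levOf (fun j => {y : Site (F.P K) 0 | (cubeSeqMT3 F n K x₀ ρ S M hM).InOm j y}) (K - n) b'.src := by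
    rw [← pow_succ']
    exact pow_le_pow_right₀ hL1 hlev
  nlinarith [mul_le_mul_of_nonneg_right hpow hη.le]

end T3

end Summit.QuantumFields.YangMills.Theorems.FlatCubeSequenceAligned

end
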